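import Mathlib
import Literature.Analysis.Calculus.SmoothCutoff
import Summits.NavierStokesRegularity.NavierStokesRegularity.Theorems.EulerZoomLiouvillePowerGaugeEulerLiouvilleWeakAxisymCasimirOffAxis

/-!
# Crux `EulerZoomLiouville.PowerGaugeEulerLiouville` (stmt-NavierStokesRegularity-19832), weak stratum, line `weak_axisym` (ns-idea-11 g9):
# X1a, PART (B2) — AXIS REMOVAL, AND THE MEMBER `axisymReduction` (= `Sig.stub_axisymReduction` δ-unfolded)

Width seat ns-ezl-w2 g6 under the LEAD ns-typeII-p2 g15.
(B2) `thetaTransport_of_offAxisLaw`: if the damped Casimir law `∫ η Dψ[W] = (1−2γ)∫ ηψ` holds for every test supported off the axis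
(part (B1), `thetaTransport_of_offAxis`), and `η ∈ L²_loc`, `V ∈ L²_loc`, `V_ϱ/ϱ = (y₀V₀+y₁V₁)/ϱ² ∈ L²_loc` (clause (3) of the stratum), then it
holds for EVERY test `ψ`: cut off the axis with `χ_n = σ((n+1)²ϱ² − 1)`, `D(ψχ_n)[W] = χ_nDψ[W] + ψσ′(…)(n+1)²·2ϱ²(γ + V_ϱ/ϱ)`, the band term is
`≤ 4 sup|σ′| · |ψ||η|(|γ| + |V_ϱ/ϱ|) ∈ L¹` and `→ 0` pointwise off the (null) axis — dominated convergence thrice.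
MEMBER `axisymReduction`: the texts of `IsProfileGradient`, `HasTransportDivergence`, `SolvesWeakVorticity`, `IsWeakAxisymNoSwirl` (line
`Lines/weak_axisym.lean`, reducible defs unfolded) imply `IsAzimuthalVorticity G ∧ SolvesThetaTransport ρ V G` (unfolded): part (A)
`curlCLM_ae_eq_eta_smul`, then (B1) + (B2) with `γ = 1/(2+ρ)`, `η = etaOf G`.

WHAT THIS IS NOT: not NS, not E — X1a is first-order weak calculus on the Ukhovskii–Yudovich stratum; 19832 is OPEN. [folklore]
-/

noncomputable section

set_option linter.dupNamespace false

open MeasureTheory Set Filter Topology Function TopologicalSpace Metric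
open scoped ENNReal NNReal RealInnerProductSpace ContDiff

namespace Summit.NavierStokesRegularity.NavierStokesRegularity.Theorems.PowerGaugeEulerLiouville.WeakAxisym

open Literature.Analysis.FunctionSpaces Literature.Analysis.FluidPDE

/-! ### The axis cut-offs `χ_n(y) = σ((n+1)²ϱ² − 1)` -/

section Cutoff

/-- The cut-off argument `g_n(y) = (n+1)²ϱ² − 1` is smooth. [folklore] -/
theorem contDiff_cutoffArg (n : ℕ) :
    ContDiff ℝ ∞ (fun y : EuclideanSpace ℝ (Fin 3) => ((n : ℝ) + 1) ^ 2 * (y 0 ^ 2 + y 1 ^ 2) - 1) :=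
  (contDiff_const.mul contDiff_cylRadSq).sub contDiff_const

/-- The axis cut-off `χ_n = σ ∘ g_n` is smooth. [folklore] -/
theorem contDiff_axisCutoff (n : ℕ) :
    ContDiff ℝ ∞ (fun y : EuclideanSpace ℝ (Fin 3) => Real.smoothTransition (((n : ℝ) + 1) ^ 2 * (y 0 ^ 2 + y 1 ^ 2) - 1)) :=
  Real.smoothTransition.contDiff.comp (contDiff_cutoffArg n)

/-- The derivative of the axis cut-off: `Dχ_n(y)[w] = σ′(g_n(y)) · (n+1)² · 2(y₀w₀ + y₁w₁)`. [folklore] -/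
theorem fderiv_axisCutoff (n : ℕ) (y w : EuclideanSpace ℝ (Fin 3)) :
    fderiv ℝ (fun y : EuclideanSpace ℝ (Fin 3) => Real.smoothTransition (((n : ℝ) + 1) ^ 2 * (y 0 ^ 2 + y 1 ^ 2) - 1)) y w =
      deriv Real.smoothTransition (((n : ℝ) + 1) ^ 2 * (y 0 ^ 2 + y 1 ^ 2) - 1) *
        (((n : ℝ) + 1) ^ 2 * (2 * (y 0 * w 0 + y 1 * w 1))) := by
  obtain ⟨Q, hQ, hQw⟩ := hasFDerivAt_cylRadSq y
  have hg : HasFDerivAt (fun y : EuclideanSpace ℝ (Fin 3) => ((n : ℝ) + 1) ^ 2 * (y 0 ^ 2 + y 1 ^ 2) - 1)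
      ((((n : ℝ) + 1) ^ 2) • Q) y := (hQ.const_mul _).sub_const _
  have hσ : HasDerivAt Real.smoothTransition (deriv Real.smoothTransition (((n : ℝ) + 1) ^ 2 * (y 0 ^ 2 + y 1 ^ 2) - 1))
      (((n : ℝ) + 1) ^ 2 * (y 0 ^ 2 + y 1 ^ 2) - 1) :=
    ((Real.smoothTransition.contDiff (n := 1)).differentiable one_ne_zero).differentiableAt.hasDerivAt
  have h := hσ.comp_hasFDerivAt y hg
  rw [show (fun y : EuclideanSpace ℝ (Fin 3) => Real.smoothTransition (((n : ℝ) + 1) ^ 2 * (y 0 ^ 2 + y 1 ^ 2) - 1)) =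
      Real.smoothTransition ∘ (fun y : EuclideanSpace ℝ (Fin 3) => ((n : ℝ) + 1) ^ 2 * (y 0 ^ 2 + y 1 ^ 2) - 1) from rfl,
    h.fderiv]
  simp only [smul_apply, smul_eq_mul, hQw]

/-- `0 ≤ χ_n ≤ 1`. [folklore] -/
theorem axisCutoff_mem_Icc (n : ℕ) (y : EuclideanSpace ℝ (Fin 3)) :
    Real.smoothTransition (((n : ℝ) + 1) ^ 2 * (y 0 ^ 2 + y 1 ^ 2) - 1) ∈ Icc (0 : ℝ) 1 :=
  ⟨Real.smoothTransition.nonneg _, Real.smoothTransition.le_one _⟩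

/-- Off the axis the cut-offs are eventually `1` and their derivatives eventually vanish. [folklore] -/
theorem eventually_axisCutoff {y : EuclideanSpace ℝ (Fin 3)} (hy : 0 < y 0 ^ 2 + y 1 ^ 2) :
    ∀ᶠ n : ℕ in atTop, Real.smoothTransition (((n : ℝ) + 1) ^ 2 * (y 0 ^ 2 + y 1 ^ 2) - 1) = 1 ∧
      deriv Real.smoothTransition (((n : ℝ) + 1) ^ 2 * (y 0 ^ 2 + y 1 ^ 2) - 1) = 0 := by
  obtain ⟨N, hN⟩ := exists_nat_gt (2 / (y 0 ^ 2 + y 1 ^ 2))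
  refine Filter.eventually_atTop.2 ⟨N, fun n hn => ?_⟩
  have h1 : 2 / (y 0 ^ 2 + y 1 ^ 2) < (n : ℝ) + 1 := hN.trans_le (by exact_mod_cast Nat.le_succ_of_le hn)
  have h2 : 2 < ((n : ℝ) + 1) * (y 0 ^ 2 + y 1 ^ 2) := by rwa [div_lt_iff₀ hy] at h1
  have h3 : ((n : ℝ) + 1) * (y 0 ^ 2 + y 1 ^ 2) ≤ ((n : ℝ) + 1) ^ 2 * (y 0 ^ 2 + y 1 ^ 2) := by
    have : (0 : ℝ) ≤ n := n.cast_nonneg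
    nlinarith
  have hgt : 1 < ((n : ℝ) + 1) ^ 2 * (y 0 ^ 2 + y 1 ^ 2) - 1 := by linarith
  exact ⟨Real.smoothTransition.one_of_one_le hgt.le, Literature.Analysis.Calculus.deriv_smoothTransition_of_one_le hgt.le⟩

/-- On the transition band (`σ′(g_n(y)) ≠ 0`) one has `(n+1)²ϱ² ≤ 2`. [folklore] -/
theorem band_of_deriv_ne_zero {n : ℕ} {y : EuclideanSpace ℝ (Fin 3)}
    (h : deriv Real.smoothTransition (((n : ℝ) + 1) ^ 2 * (y 0 ^ 2 + y 1 ^ 2) - 1) ≠ 0) :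
    ((n : ℝ) + 1) ^ 2 * (y 0 ^ 2 + y 1 ^ 2) ≤ 2 := by
  by_contra hlt
  exact h (Literature.Analysis.Calculus.deriv_smoothTransition_of_one_le (by linarith [not_le.1 hlt]))

end Cutoff

/-! ### Axis removal -/

section AxisRemoval

variable {γ : ℝ} {V : EuclideanSpace ℝ (Fin 3) → EuclideanSpace ℝ (Fin 3)} {η : EuclideanSpace ℝ (Fin 3) → ℝ}

/-- **X1a (B2): AXIS REMOVAL.**  Let `V, η ∈ L²_loc(ℝ³)` and `V_ϱ/ϱ = (y₀V₀+y₁V₁)/ϱ² ∈ L²_loc`, `W = γ(y−0) + V`.  If the damped Casimir law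
`∫ η Dψ[W] = (1−2γ)∫ ηψ` holds for every test `ψ` whose support keeps a distance from the axis, then it holds for every test `ψ`. [folklore] -/
theorem thetaTransport_of_offAxisLaw
    (hV2 : ∀ r : ℝ, MemLp V 2 (volume.restrict (ball (0 : EuclideanSpace ℝ (Fin 3)) r)))
    (hη2 : ∀ r : ℝ, MemLp η 2 (volume.restrict (ball (0 : EuclideanSpace ℝ (Fin 3)) r)))
    (hf2 : ∀ r : ℝ, MemLp (fun y : EuclideanSpace ℝ (Fin 3) => (y 0 * V y 0 + y 1 * V y 1) / (y 0 ^ 2 + y 1 ^ 2)) 2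
      (volume.restrict (ball (0 : EuclideanSpace ℝ (Fin 3)) r)))
    (hlaw : ∀ ψ : EuclideanSpace ℝ (Fin 3) → ℝ, IsTestFunctionOn (⊤ : Opens (EuclideanSpace ℝ (Fin 3))) ψ →
      ∀ δ : ℝ, 0 < δ → (∀ y ∈ tsupport ψ, δ ≤ y 0 ^ 2 + y 1 ^ 2) →
        ∫ y, η y * fderiv ℝ ψ y (selfSimilarTransport γ 0 V y) = (1 - 2 * γ) * ∫ y, η y * ψ y)
    {ψ : EuclideanSpace ℝ (Fin 3) → ℝ} (hψ : IsTestFunctionOn (⊤ : Opens (EuclideanSpace ℝ (Fin 3))) ψ) :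
    ∫ y, η y * fderiv ℝ ψ y (selfSimilarTransport γ 0 V y) = (1 - 2 * γ) * ∫ y, η y * ψ y := by
  set W : EuclideanSpace ℝ (Fin 3) → EuclideanSpace ℝ (Fin 3) := selfSimilarTransport γ 0 V with hW
  have hW2 : ∀ r : ℝ, MemLp W 2 (volume.restrict (ball (0 : EuclideanSpace ℝ (Fin 3)) r)) :=
    memLp_selfSimilarTransport_ball hV2 γ
  have hWm : AEStronglyMeasurable W volume := aestronglyMeasurable_of_memLp_ball' hW2
  have hηm : AEStronglyMeasurable η volume := aestronglyMeasurable_of_memLp_ball' hη2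
  have hψc : Continuous ψ := hψ.contDiff.continuous
  have hψd : ∀ y, DifferentiableAt ℝ ψ y := fun y => (hψ.contDiff.differentiable (by simp)).differentiableAt
  have hDψc : Continuous (fderiv ℝ ψ) := hψ.contDiff.continuous_fderiv (by simp)
  -- ### the cut-offs `χ_n = σ((n+1)²ϱ² − 1)`
  set χ : ℕ → EuclideanSpace ℝ (Fin 3) → ℝ := fun n y =>
    Real.smoothTransition (((n : ℝ) + 1) ^ 2 * (y 0 ^ 2 + y 1 ^ 2) - 1) with hχ
  have hχs : ∀ n, ContDiff ℝ ∞ (χ n) := fun n => contDiff_axisCutoff n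
  have hχc : ∀ n, Continuous (χ n) := fun n => (hχs n).continuous
  have hχd : ∀ n y, DifferentiableAt ℝ (χ n) y := fun n y => ((hχs n).differentiable (by simp)).differentiableAt
  have hDχc : ∀ n, Continuous (fderiv ℝ (χ n)) := fun n => (hχs n).continuous_fderiv (by simp)
  have hχ01 : ∀ n y, χ n y ∈ Icc (0 : ℝ) 1 := fun n y => axisCutoff_mem_Icc n y
  -- `ψ χ_n` is a test supported off the axis
  have hψn : ∀ n, IsTestFunctionOn (⊤ : Opens (EuclideanSpace ℝ (Fin 3))) (fun y => ψ y * χ n y) := fun n =>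
    ⟨hψ.contDiff.mul (hχs n), hψ.hasCompactSupport.mul_right, by simp⟩
  have hoffn : ∀ n, ∀ y ∈ tsupport (fun y => ψ y * χ n y), (((n : ℝ) + 1) ^ 2)⁻¹ ≤ y 0 ^ 2 + y 1 ^ 2 := by
    intro n y hy
    by_contra hlt
    rw [not_le] at hlt
    have hpos : (0 : ℝ) < ((n : ℝ) + 1) ^ 2 := by positivity
    have hneg : ((n : ℝ) + 1) ^ 2 * (y 0 ^ 2 + y 1 ^ 2) - 1 < 0 := by
      have h := mul_lt_mul_of_pos_left hlt hpos
      rw [mul_inv_cancel₀ hpos.ne'] at h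
      linarith
    have hev : (fun y => ψ y * χ n y) =ᶠ[𝓝 y] 0 := by
      filter_upwards [(isOpen_lt (contDiff_cutoffArg n).continuous continuous_const).mem_nhds hneg] with z hz
      rw [Pi.zero_apply, show χ n z = 0 from Real.smoothTransition.zero_of_nonpos (le_of_lt hz), mul_zero]
    exact (notMem_tsupport_iff_eventuallyEq.2 hev) hy
  have hEn : ∀ n, ∫ y, η y * fderiv ℝ (fun y => ψ y * χ n y) y (W y) = (1 - 2 * γ) * ∫ y, η y * (ψ y * χ n y) :=
    fun n => hlaw _ (hψn n) _ (by positivity) (hoffn n)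
  -- ### product rule and the band estimate
  have hprod : ∀ n y, fderiv ℝ (fun y => ψ y * χ n y) y (W y) = χ n y * fderiv ℝ ψ y (W y) + ψ y * fderiv ℝ (χ n) y (W y) := by
    intro n y
    rw [fderiv_fun_mul (hψd y) (hχd n y)]
    simp only [add_apply, smul_apply, smul_eq_mul]
    ring
  obtain ⟨M, hM0, hM⟩ := Literature.Analysis.Calculus.exists_bound_deriv_smoothTransition
  set f : EuclideanSpace ℝ (Fin 3) → ℝ := fun y => (y 0 * V y 0 + y 1 * V y 1) / (y 0 ^ 2 + y 1 ^ 2) with hf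
  have hband : ∀ n y, ‖ψ y * fderiv ℝ (χ n) y (W y)‖ ≤ ‖ψ y‖ * (4 * M * (‖γ‖ + ‖f y‖)) := by
    intro n y
    have hpos : (0 : ℝ) < ((n : ℝ) + 1) ^ 2 := by positivity
    rw [norm_mul]
    refine mul_le_mul_of_nonneg_left ?_ (norm_nonneg _)
    change ‖fderiv ℝ (fun y : EuclideanSpace ℝ (Fin 3) =>
      Real.smoothTransition (((n : ℝ) + 1) ^ 2 * (y 0 ^ 2 + y 1 ^ 2) - 1)) y (W y)‖ ≤ _
    rw [fderiv_axisCutoff]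
    by_cases hσ : deriv Real.smoothTransition (((n : ℝ) + 1) ^ 2 * (y 0 ^ 2 + y 1 ^ 2) - 1) = 0
    · rw [hσ, zero_mul, norm_zero]; positivity
    · have hb := band_of_deriv_ne_zero hσ
      have hq : 0 < y 0 ^ 2 + y 1 ^ 2 := by
        rcases (eq_or_lt_of_le (by positivity : (0 : ℝ) ≤ y 0 ^ 2 + y 1 ^ 2)) with h | h
        · exfalso
          apply hσ
          rw [← h, mul_zero, zero_sub]
          exact Literature.Analysis.Calculus.deriv_smoothTransition_of_nonpos (by norm_num)
        · exact h
      have hW0 : W y 0 = γ * y 0 + V y 0 := by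
        simp only [hW, selfSimilarTransport_apply, sub_zero, PiLp.add_apply, PiLp.smul_apply, smul_eq_mul]
      have hW1 : W y 1 = γ * y 1 + V y 1 := by
        simp only [hW, selfSimilarTransport_apply, sub_zero, PiLp.add_apply, PiLp.smul_apply, smul_eq_mul]
      have hWc : y 0 * W y 0 + y 1 * W y 1 = (y 0 ^ 2 + y 1 ^ 2) * (γ + f y) := by
        rw [hW0, hW1, hf]
        field_simp
        ring
      rw [hWc, Real.norm_eq_abs, abs_mul, abs_mul, abs_mul, abs_mul, abs_of_pos hq, abs_of_pos hpos, abs_two]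
      have h1 : |deriv Real.smoothTransition (((n : ℝ) + 1) ^ 2 * (y 0 ^ 2 + y 1 ^ 2) - 1)| ≤ M := hM _
      have h2 : |γ + f y| ≤ ‖γ‖ + ‖f y‖ := by rw [Real.norm_eq_abs, Real.norm_eq_abs]; exact abs_add_le _ _
      calc |deriv Real.smoothTransition (((n : ℝ) + 1) ^ 2 * (y 0 ^ 2 + y 1 ^ 2) - 1)| *
            (((n : ℝ) + 1) ^ 2 * (2 * ((y 0 ^ 2 + y 1 ^ 2) * |γ + f y|)))
          = 2 * (|deriv Real.smoothTransition (((n : ℝ) + 1) ^ 2 * (y 0 ^ 2 + y 1 ^ 2) - 1)| *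
              ((((n : ℝ) + 1) ^ 2 * (y 0 ^ 2 + y 1 ^ 2)) * |γ + f y|)) := by ring
        _ ≤ 2 * (M * (2 * (‖γ‖ + ‖f y‖))) := by gcongr
        _ = 4 * M * (‖γ‖ + ‖f y‖) := by ring
  -- ### integrable dominators
  have I3 : Integrable (fun y => η y * fderiv ℝ ψ y (W y)) volume := integrable_eta_mul_fderiv_test hη2 hW2 hψ
  have I4 : Integrable (fun y => η y * ψ y) volume := integrable_eta_mul_test hη2 hψ
  have hloc : LocallyIntegrable (fun y => ‖η y‖ * (4 * M * (‖γ‖ + ‖f y‖))) volume := by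
    refine (locallyIntegrable_iff).2 fun K hK => ?_
    obtain ⟨r, hr⟩ := hK.isBounded.subset_ball (0 : EuclideanSpace ℝ (Fin 3))
    haveI : IsFiniteMeasure ((volume : Measure (EuclideanSpace ℝ (Fin 3))).restrict (ball (0 : EuclideanSpace ℝ (Fin 3)) r)) :=
      isFiniteMeasure_restrict.2 measure_ball_lt_top.ne
    have i1 : IntegrableOn (fun y => ‖η y‖) (ball (0 : EuclideanSpace ℝ (Fin 3)) r) volume :=
      ((hη2 r).integrable one_le_two).norm
    have i2 : IntegrableOn (fun y => ‖η y‖ * ‖f y‖) (ball (0 : EuclideanSpace ℝ (Fin 3)) r) volume :=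
      (hη2 r).norm.integrable_mul (hf2 r).norm
    have i3 : IntegrableOn (fun y => 4 * M * ‖γ‖ * ‖η y‖ + 4 * M * (‖η y‖ * ‖f y‖)) (ball (0 : EuclideanSpace ℝ (Fin 3)) r) volume :=
      (i1.const_mul _).add (i2.const_mul _)
    exact (i3.congr_fun (fun y _ => by ring) measurableSet_ball).mono_set hr
  have Ibd : Integrable (fun y => ‖ψ y‖ * (‖η y‖ * (4 * M * (‖γ‖ + ‖f y‖)))) volume :=
    hloc.integrable_smul_left_of_hasCompactSupport hψc.norm hψ.hasCompactSupport.norm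
  -- ### the three sequences and their dominated limits
  have hAm : ∀ n, AEStronglyMeasurable (fun y => η y * (χ n y * fderiv ℝ ψ y (W y))) volume := fun n =>
    hηm.mul ((hχc n).aestronglyMeasurable.mul (aestronglyMeasurable_fderiv_apply hDψc hWm))
  have hBm : ∀ n, AEStronglyMeasurable (fun y => η y * (ψ y * fderiv ℝ (χ n) y (W y))) volume := fun n =>
    hηm.mul (hψc.aestronglyMeasurable.mul (aestronglyMeasurable_fderiv_apply (hDχc n) hWm))
  have hCm : ∀ n, AEStronglyMeasurable (fun y => η y * (ψ y * χ n y)) volume := fun n =>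
    hηm.mul (hψc.aestronglyMeasurable.mul (hχc n).aestronglyMeasurable)
  have hχle : ∀ n y, ‖χ n y‖ ≤ 1 := fun n y => by
    rw [Real.norm_of_nonneg (hχ01 n y).1]; exact (hχ01 n y).2
  have hAbd : ∀ n, ∀ᵐ y ∂(volume : Measure (EuclideanSpace ℝ (Fin 3))),
      ‖η y * (χ n y * fderiv ℝ ψ y (W y))‖ ≤ ‖η y * fderiv ℝ ψ y (W y)‖ := fun n => ae_of_all _ fun y => by
    rw [norm_mul, norm_mul, norm_mul]
    calc ‖η y‖ * (‖χ n y‖ * ‖fderiv ℝ ψ y (W y)‖) ≤ ‖η y‖ * (1 * ‖fderiv ℝ ψ y (W y)‖) := by gcongr; exact hχle n y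
      _ = ‖η y‖ * ‖fderiv ℝ ψ y (W y)‖ := by ring
  have hBbd : ∀ n, ∀ᵐ y ∂(volume : Measure (EuclideanSpace ℝ (Fin 3))),
      ‖η y * (ψ y * fderiv ℝ (χ n) y (W y))‖ ≤ ‖ψ y‖ * (‖η y‖ * (4 * M * (‖γ‖ + ‖f y‖))) := fun n => ae_of_all _ fun y => by
    rw [norm_mul]
    calc ‖η y‖ * ‖ψ y * fderiv ℝ (χ n) y (W y)‖ ≤ ‖η y‖ * (‖ψ y‖ * (4 * M * (‖γ‖ + ‖f y‖))) :=
        mul_le_mul_of_nonneg_left (hband n y) (norm_nonneg _)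
      _ = ‖ψ y‖ * (‖η y‖ * (4 * M * (‖γ‖ + ‖f y‖))) := by ring
  have hCbd : ∀ n, ∀ᵐ y ∂(volume : Measure (EuclideanSpace ℝ (Fin 3))),
      ‖η y * (ψ y * χ n y)‖ ≤ ‖η y * ψ y‖ := fun n => ae_of_all _ fun y => by
    rw [norm_mul, norm_mul, norm_mul]
    calc ‖η y‖ * (‖ψ y‖ * ‖χ n y‖) ≤ ‖η y‖ * (‖ψ y‖ * 1) := by gcongr; exact hχle n y
      _ = ‖η y‖ * ‖ψ y‖ := by ring
  have hq : ∀ᵐ y ∂(volume : Measure (EuclideanSpace ℝ (Fin 3))), 0 < y 0 ^ 2 + y 1 ^ 2 := by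
    filter_upwards [ae_coord_zero_ne_zero] with y hy
    positivity
  have hAlim : ∀ᵐ y ∂(volume : Measure (EuclideanSpace ℝ (Fin 3))),
      Tendsto (fun n => η y * (χ n y * fderiv ℝ ψ y (W y))) atTop (𝓝 (η y * fderiv ℝ ψ y (W y))) := by
    filter_upwards [hq] with y hy
    refine tendsto_const_nhds.congr' ?_
    filter_upwards [eventually_axisCutoff hy] with n hn
    rw [show χ n y = 1 from hn.1, one_mul]
  have hBlim : ∀ᵐ y ∂(volume : Measure (EuclideanSpace ℝ (Fin 3))),
      Tendsto (fun n => η y * (ψ y * fderiv ℝ (χ n) y (W y))) atTop (𝓝 ((fun _ => (0 : ℝ)) y)) := by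
    filter_upwards [hq] with y hy
    refine tendsto_const_nhds.congr' ?_
    filter_upwards [eventually_axisCutoff hy] with n hn
    have h0 : fderiv ℝ (χ n) y (W y) = 0 := by
      change fderiv ℝ (fun y : EuclideanSpace ℝ (Fin 3) =>
        Real.smoothTransition (((n : ℝ) + 1) ^ 2 * (y 0 ^ 2 + y 1 ^ 2) - 1)) y (W y) = 0
      rw [fderiv_axisCutoff, hn.2, zero_mul]
    rw [h0, mul_zero, mul_zero]
  have hClim : ∀ᵐ y ∂(volume : Measure (EuclideanSpace ℝ (Fin 3))),
      Tendsto (fun n => η y * (ψ y * χ n y)) atTop (𝓝 (η y * ψ y)) := by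
    filter_upwards [hq] with y hy
    refine tendsto_const_nhds.congr' ?_
    filter_upwards [eventually_axisCutoff hy] with n hn
    rw [show χ n y = 1 from hn.1, mul_one]
  have hA := tendsto_integral_of_dominated_convergence _ hAm I3.norm hAbd hAlim
  have hB := tendsto_integral_of_dominated_convergence _ hBm Ibd hBbd hBlim
  have hC := tendsto_integral_of_dominated_convergence _ hCm I4.norm hCbd hClim
  rw [integral_zero] at hB
  -- ### the identity at level `n` and the limit
  have hIdn : ∀ n, (∫ y, η y * (χ n y * fderiv ℝ ψ y (W y))) + (∫ y, η y * (ψ y * fderiv ℝ (χ n) y (W y))) =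
      (1 - 2 * γ) * ∫ y, η y * (ψ y * χ n y) := by
    intro n
    have IA : Integrable (fun y => η y * (χ n y * fderiv ℝ ψ y (W y))) volume := I3.norm.mono' (hAm n) (hAbd n)
    have IB : Integrable (fun y => η y * (ψ y * fderiv ℝ (χ n) y (W y))) volume := Ibd.mono' (hBm n) (hBbd n)
    rw [← integral_add IA IB, ← hEn n]
    refine integral_congr_ae (ae_of_all _ fun y => ?_)
    show η y * (χ n y * fderiv ℝ ψ y (W y)) + η y * (ψ y * fderiv ℝ (χ n) y (W y)) = η y * fderiv ℝ (fun y => ψ y * χ n y) y (W y)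
    rw [hprod n y]
    ring
  have hlim1 : Tendsto (fun n => (∫ y, η y * (χ n y * fderiv ℝ ψ y (W y))) + (∫ y, η y * (ψ y * fderiv ℝ (χ n) y (W y))))
      atTop (𝓝 ((∫ y, η y * fderiv ℝ ψ y (W y)) + 0)) := hA.add hB
  have hlim2 : Tendsto (fun n => (1 - 2 * γ) * ∫ y, η y * (ψ y * χ n y)) atTop (𝓝 ((1 - 2 * γ) * ∫ y, η y * ψ y)) :=
    hC.const_mul _
  have h := tendsto_nhds_unique (hlim1.congr fun n => hIdn n) hlim2
  rwa [add_zero] at h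

end AxisRemoval

/-! ### The member: `Sig.stub_axisymReduction` δ-unfolded -/

section Member

/-- **X1a, THE MEMBER (`Sig.stub_axisymReduction` of `Lines/weak_axisym.lean` with the line's reducible definitions unfolded):**
for `0 < ρ ≤ ½`, DiPerna–Lions data `(V, G)` (`IsProfileGradient`), `div W = 3γ` (`HasTransportDivergence`, unused), the weak vorticity
equation (`SolvesWeakVorticity`) and the Ukhovskii–Yudovich axisymmetric swirl-free stratum (`IsWeakAxisymNoSwirl`; clause (5) unused) imply:
the vorticity is azimuthal (`IsAzimuthalVorticity G`, part (A)) and the Casimir `η = ⟪Ω, k×y⟫/ϱ²` solves the damped transport law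
`∫ η Dψ[W] = (1 − 2γ)∫ η ψ` for every test `ψ` (`SolvesThetaTransport ρ V G`; parts (B1) + (B2)), `γ = 1/(2+ρ)`, `W = transportW ρ V`.
WHAT THIS IS NOT: not NS, not E — first-order weak calculus; 19832 is OPEN. [folklore] -/
theorem axisymReduction {ρ : ℝ} (_hρ : 0 < ρ) (_hρh : ρ ≤ 1 / 2)
    {V : EuclideanSpace ℝ (Fin 3) → EuclideanSpace ℝ (Fin 3)}
    {G : EuclideanSpace ℝ (Fin 3) → EuclideanSpace ℝ (Fin 3) →L[ℝ] EuclideanSpace ℝ (Fin 3)}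
    (hG : HasWeakFDerivOn (⊤ : Opens (EuclideanSpace ℝ (Fin 3))) volume V G ∧
      (∀ r : ℝ, MemLp G 2 (volume.restrict (ball (0 : EuclideanSpace ℝ (Fin 3)) r))) ∧
      (∀ r : ℝ, MemLp V 6 (volume.restrict (ball (0 : EuclideanSpace ℝ (Fin 3)) r))) ∧
      HasWeakFDerivOn (⊤ : Opens (EuclideanSpace ℝ (Fin 3))) volume (selfSimilarTransport (1 / (2 + ρ)) 0 V)
        (fun x => (1 / (2 + ρ)) • ContinuousLinearMap.id ℝ (EuclideanSpace ℝ (Fin 3)) + G x))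
    (_hdiv : ∀ φ : EuclideanSpace ℝ (Fin 3) → ℝ, IsTestFunctionOn (⊤ : Opens (EuclideanSpace ℝ (Fin 3))) φ →
      ∫ y, inner ℝ (selfSimilarTransport (1 / (2 + ρ)) 0 V y) (gradient φ y) = -(3 * (1 / (2 + ρ))) * ∫ y, φ y)
    (hvort : ∀ ψ : EuclideanSpace ℝ (Fin 3) → ℝ, IsTestFunctionOn (⊤ : Opens (EuclideanSpace ℝ (Fin 3))) ψ →
      ∀ e : EuclideanSpace ℝ (Fin 3),
        ∫ y, inner ℝ (curlCLM (G y)) e * fderiv ℝ ψ y (selfSimilarTransport (1 / (2 + ρ)) 0 V y) =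
          ∫ y, ψ y * inner ℝ ((1 - 3 * (1 / (2 + ρ))) • curlCLM (G y) - G y (curlCLM (G y))) e)
    (hax : (∀ᵐ y ∂(volume : Measure (EuclideanSpace ℝ (Fin 3))),
        G y (WithLp.toLp 2 ![-(y 1), y 0, 0]) = WithLp.toLp 2 ![-(V y 1), V y 0, 0]) ∧
      (∀ᵐ y ∂(volume : Measure (EuclideanSpace ℝ (Fin 3))), inner ℝ (V y) (WithLp.toLp 2 ![-(y 1), y 0, 0]) = 0) ∧
      (∀ r : ℝ, MemLp (fun y => inner ℝ (V y) (WithLp.toLp 2 ![y 0, y 1, 0]) / (y 0 ^ 2 + y 1 ^ 2)) 2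
        (volume.restrict (ball (0 : EuclideanSpace ℝ (Fin 3)) r))) ∧
      (∀ r : ℝ, MemLp (fun y => inner ℝ (curlCLM (G y)) (WithLp.toLp 2 ![-(y 1), y 0, 0]) / (y 0 ^ 2 + y 1 ^ 2)) 2
        (volume.restrict (ball (0 : EuclideanSpace ℝ (Fin 3)) r))) ∧
      (∃ C m : ℝ, m < 1 ∧ ∀ R : ℝ, 1 ≤ R →
        ∫ y in ball (0 : EuclideanSpace ℝ (Fin 3)) R,
          (inner ℝ (curlCLM (G y)) (WithLp.toLp 2 ![-(y 1), y 0, 0]) / (y 0 ^ 2 + y 1 ^ 2)) ^ 2 ≤ C * R ^ m)) :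
    (∀ᵐ y ∂(volume : Measure (EuclideanSpace ℝ (Fin 3))),
      curlCLM (G y) =
        (inner ℝ (curlCLM (G y)) (WithLp.toLp 2 ![-(y 1), y 0, 0]) / (y 0 ^ 2 + y 1 ^ 2)) • WithLp.toLp 2 ![-(y 1), y 0, 0]) ∧
    (∀ ψ : EuclideanSpace ℝ (Fin 3) → ℝ, IsTestFunctionOn (⊤ : Opens (EuclideanSpace ℝ (Fin 3))) ψ →
      ∫ y, (inner ℝ (curlCLM (G y)) (WithLp.toLp 2 ![-(y 1), y 0, 0]) / (y 0 ^ 2 + y 1 ^ 2)) *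
          fderiv ℝ ψ y (selfSimilarTransport (1 / (2 + ρ)) 0 V y) =
        (1 - 2 * (1 / (2 + ρ))) *
          ∫ y, (inner ℝ (curlCLM (G y)) (WithLp.toLp 2 ![-(y 1), y 0, 0]) / (y 0 ^ 2 + y 1 ^ 2)) * ψ y) := by
  obtain ⟨hVG, hG2, hV6, -⟩ := hG
  obtain ⟨h1, h2, hf2, hη2, -⟩ := hax
  have hazi := curlCLM_ae_eq_eta_smul hVG h1 h2
  refine ⟨hazi, fun ψ hψ => ?_⟩
  have hV2 : ∀ r : ℝ, MemLp V 2 (volume.restrict (ball (0 : EuclideanSpace ℝ (Fin 3)) r)) := fun r => by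
    haveI : IsFiniteMeasure ((volume : Measure (EuclideanSpace ℝ (Fin 3))).restrict (ball (0 : EuclideanSpace ℝ (Fin 3)) r)) :=
      isFiniteMeasure_restrict.2 measure_ball_lt_top.ne
    exact (hV6 r).mono_exponent (by norm_num)
  have ef : (fun y : EuclideanSpace ℝ (Fin 3) => inner ℝ (V y) (WithLp.toLp 2 ![y 0, y 1, 0]) / (y 0 ^ 2 + y 1 ^ 2)) =
      fun y => (y 0 * V y 0 + y 1 * V y 1) / (y 0 ^ 2 + y 1 ^ 2) := by
    funext y
    congr 1
    simp only [PiLp.inner_apply, Fin.sum_univ_three, RCLike.inner_apply, conj_trivial,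
      Matrix.cons_val_zero, Matrix.cons_val_one, Matrix.cons_val_two, Matrix.head_cons, Matrix.tail_cons]
    ring
  rw [ef] at hf2
  have hlaw : ∀ φ : EuclideanSpace ℝ (Fin 3) → ℝ, IsTestFunctionOn (⊤ : Opens (EuclideanSpace ℝ (Fin 3))) φ →
      ∀ δ : ℝ, 0 < δ → (∀ y ∈ tsupport φ, δ ≤ y 0 ^ 2 + y 1 ^ 2) →
        ∫ y, (inner ℝ (curlCLM (G y)) (WithLp.toLp 2 ![-(y 1), y 0, 0]) / (y 0 ^ 2 + y 1 ^ 2)) *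
            fderiv ℝ φ y (selfSimilarTransport (1 / (2 + ρ)) 0 V y) =
          (1 - 2 * (1 / (2 + ρ))) * ∫ y, (inner ℝ (curlCLM (G y)) (WithLp.toLp 2 ![-(y 1), y 0, 0]) / (y 0 ^ 2 + y 1 ^ 2)) * φ y :=
    fun φ hφ δ hδ hoff =>
      thetaTransport_of_offAxis (η := fun y => inner ℝ (curlCLM (G y)) (WithLp.toLp 2 ![-(y 1), y 0, 0]) / (y 0 ^ 2 + y 1 ^ 2))
        hV2 hG2 hη2 h1 hazi hvort hφ hδ hoff
  exact thetaTransport_of_offAxisLaw hV2 hη2 hf2 hlaw hψ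

end Member

end Summit.NavierStokesRegularity.NavierStokesRegularity.Theorems.PowerGaugeEulerLiouville.WeakAxisym

end
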